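import Summits.AtomisticToContinuum.Crystallization.Theorems.ChargedEnergyGap.Negative.BlocksBound
import Literature.MathematicalPhysics.StatisticalMechanics.MuGSC

/-!
# Crux `LayeredLawsSelectHcp` (stmt-AtomisticToContinuum-9226), line `mtp-prestress-split-ergodic-frame`:
# a periodic Sütő `μ`-ground-state configuration has energy per particle `≤ μ`

Registered sub-goal `tube_muGSC_periodic_energy_le` of the crux item (a sub-goal of the zero-defect stub
`stub_tubeZeroDefect`, Liouville route: once a sample of a minimising layered law is known to be an affine /
periodic crystal, its cell is pinned by this fact together with `eStar_le`): if the point set `F + G` of a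
PERIODIC configuration `Q` of `ℝ³` is a `μ`GSC of Lennard-Jones at chemical potential `μc`
(`IsMuGSC lennardJones μc Q.points`), then `e(Q) ≤ μc`.  With `μc = e* = ⨅ e` and `eStar_le Q : e* ≤ e(Q)` this
says: a periodic `μ`GSC at `e*` is a periodic ground state, `e(Q) = e*`.

Proof (removal test on big blocks; all asymptotics are the landed block calculus of
`ChargedEnergyGap/Negative/Blocks{Energy,Tails,Bound}`): remove the block `F + {Σ kᵢbᵢ : 0 ≤ kᵢ < K}` of
`n = #F·K³` points.  Sütő's removal inequality (`IsMuGSC.removal`) reads `U(block) + I(block, Q ∖ block) ≤ μc·n`;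
the field term `I(block, Q ∖ block)` is exactly the sum of the block tails `Σ_u tail u`
(`fieldEnergy_blockConfig_eq`, a re-indexing), and the exact energy identity
`2·U(block) = 2n·e(Q) − Σ_u tail u` (`two_mul_energy_block_eq`) turns the removal inequality into
`2n·e(Q) + Σ_u tail u ≤ 2μc·n`.  Finally `Σ_u tail u ≥ −(1/6) Σ_u tailSix u ≥ −2εn` for `K ≥ K₀(ε)`
(`neg_tailSix_le_tail`, `exists_sum_tailSix_le`), so `e(Q) ≤ μc + ε` for every `ε > 0`.  [folklore]
-/

noncomputable section

open MeasureTheory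
open scoped BigOperators

namespace Summit.AtomisticToContinuum.Crystallization.Theorems.PalmUnimodularRigidity.LayeredLawsSelectHcp

open Literature.MathematicalPhysics.StatisticalMechanics
open Summit.AtomisticToContinuum.Crystallization.Theorems.ChargedEnergyGapNegative (eStar eStar_le)
open Summit.AtomisticToContinuum.Crystallization.Theorems.ChargedEnergyGapNegative.Blocks

variable (Q : PeriodicConfiguration 3) (K : ℕ)

/-- The range of the block configuration is the range of the block-point map (re-indexing by
`Fintype.equivFin`). [folklore] -/
theorem range_blockConfig : Set.range (blockConfig Q K) = Set.range (bpt Q K) := by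
  unfold blockConfig
  exact EquivLike.range_comp _ _

/-- Block points are points of `Q`: `range blockConfig ⊆ Q.points`. [folklore] -/
theorem range_blockConfig_subset : Set.range (blockConfig Q K) ⊆ Q.points := by
  rw [range_blockConfig]
  rintro _ ⟨u, rfl⟩
  exact bpt_mem Q K u

/-- Block points lie in the range of the block configuration. [folklore] -/
theorem bpt_mem_range_blockConfig (u : BIdx Q K) : bpt Q K u ∈ Set.range (blockConfig Q K) := by
  rw [range_blockConfig]
  exact ⟨u, rfl⟩

/-- **The field sum at a block point over `Q ∖ block` is the block tail**: the points of `Q` outside the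
block, seen from the block point `v`, are exactly the "other points at `v`" outside `blockOthers v`
(an explicit bijection of the two index sets, then `Equiv.tsum_eq`). [folklore] -/
theorem tsum_outside_eq_tail (V : ℝ → ℝ) (v : BIdx Q K) :
    ∑' y : ↥(Q.points \ Set.range (blockConfig Q K)), V (dist (bpt Q K v) y) = tail Q K V v := by
  -- the identification of the two index sets
  let e : ↥(Q.points \ Set.range (blockConfig Q K)) ≃
      ↥((blockOthers Q K v : Set {q : EuclideanSpace ℝ (Fin 3) // q ∈ Q.points ∧ q ≠ bpt Q K v})ᶜ) :=
    { toFun := fun y =>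
        ⟨⟨y.1, y.2.1, fun h => y.2.2 (h ▸ bpt_mem_range_blockConfig Q K v)⟩, by
          rw [Set.mem_compl_iff, Finset.mem_coe]
          intro hmem
          obtain ⟨w, -, hw⟩ := Finset.mem_image.1 hmem
          have hw' : bpt Q K w.1 = y.1 := congrArg Subtype.val hw
          exact y.2.2 (hw' ▸ bpt_mem_range_blockConfig Q K w.1)⟩
      invFun := fun q =>
        ⟨q.1.1, q.1.2.1, by
          rw [range_blockConfig]
          rintro ⟨w, hw⟩
          by_cases hwv : w = v
          · exact q.1.2.2 (by rw [← hw, hwv])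
          · have hq := q.2
            rw [Set.mem_compl_iff, Finset.mem_coe] at hq
            exact hq (Finset.mem_image.2 ⟨⟨w, Finset.mem_erase.2 ⟨hwv, Finset.mem_univ w⟩⟩,
              Finset.mem_attach _ _, Subtype.ext hw⟩)⟩
      left_inv := fun _ => rfl
      right_inv := fun _ => rfl }
  unfold tail
  exact e.tsum_eq fun q => V (dist (bpt Q K v) q.1.1)

/-- **The field of the block in `Q ∖ block` is the sum of the block tails**:
`I(block, Q ∖ block) = Σ_u tail u`. [folklore] -/
theorem fieldEnergy_blockConfig_eq (V : ℝ → ℝ) :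
    fieldEnergy V (blockConfig Q K) (Q.points \ Set.range (blockConfig Q K)) =
      ∑ u : BIdx Q K, tail Q K V u := by
  unfold fieldEnergy
  rw [← (Fintype.equivFin (BIdx Q K)).symm.sum_comp]
  refine Finset.sum_congr rfl fun a _ => ?_
  rw [blockConfig_apply]
  exact tsum_outside_eq_tail Q K V _

/-- **Registered sub-goal `tube_muGSC_periodic_energy_le` (serves `stub_tubeZeroDefect`).**  A periodic
configuration of `ℝ³` whose point set is a Sütő `μ`-ground-state configuration of Lennard-Jones at chemical
potential `μc` has energy per particle `e(Q) ≤ μc`: the removal test on the blocks `F + [0,K)³·b`, the exact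
block energy identity and the `o(K³)` tail bound.  (With `μc = e*` and `eStar_le`: a periodic `μ`GSC at `e*`
is a periodic ground state.) [folklore] -/
theorem tube_muGSC_periodic_energy_le :
    ∀ (μc : ℝ) (Q : PeriodicConfiguration 3), IsMuGSC lennardJones μc Q.points →
      Q.energyPerParticle lennardJones ≤ μc := by
  intro μc Q hQ
  refine le_of_forall_pos_le_add fun ε hε => ?_
  obtain ⟨K, hK0, hK⟩ := exists_sum_tailSix_le Q (show 0 < 6 * ε by positivity)
  have hsum := hK K le_rfl
  have hF : (0 : ℝ) < Q.motif.card := by exact_mod_cast Q.motif_nonempty.card_pos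
  have hKr : (0 : ℝ) < (K : ℝ) ^ 3 := by positivity
  -- the removal test on the block of `#F·K³` points
  have hrem := hQ.removal (blockConfig_injective Q K) (range_blockConfig_subset Q K)
  rw [fieldEnergy_blockConfig_eq] at hrem
  have hn : ((Fintype.card (BIdx Q K) : ℕ) : ℝ) = Q.motif.card * (K : ℝ) ^ 3 := by
    exact_mod_cast card_BIdx Q K
  rw [hn] at hrem
  -- the exact energy identity and the tail bound
  have hid := two_mul_energy_block_eq Q K
  have htail : -(1 / 6 * ∑ u : BIdx Q K, tailSix Q K u) ≤ ∑ u : BIdx Q K, tail Q K lennardJones u := by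
    rw [Finset.mul_sum, ← Finset.sum_neg_distrib]
    exact Finset.sum_le_sum fun u _ => neg_tailSix_le_tail Q K u
  -- conclude: `2#F K³ · (e − ε − μc) ≤ 0`
  by_contra hlt
  rw [not_le] at hlt
  have hpos : (0 : ℝ) < 2 * Q.motif.card * (K : ℝ) ^ 3 := by positivity
  have hprod : 0 < 2 * Q.motif.card * (K : ℝ) ^ 3 * (Q.energyPerParticle lennardJones - (μc + ε)) :=
    mul_pos hpos (sub_pos.2 hlt)
  nlinarith [hrem, hid, htail, hsum, hprod]

/-- Read-back at `μc = e*`: a periodic `μ`GSC of Lennard-Jones at `e*` is a periodic ground state,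
`e(Q) = e*`. [folklore] -/
theorem energyPerParticle_eq_eStar_of_isMuGSC (Q : PeriodicConfiguration 3)
    (h : IsMuGSC lennardJones eStar Q.points) : Q.energyPerParticle lennardJones = eStar :=
  le_antisymm (tube_muGSC_periodic_energy_le eStar Q h) (eStar_le Q)

end Summit.AtomisticToContinuum.Crystallization.Theorems.PalmUnimodularRigidity.LayeredLawsSelectHcp

end
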